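import Summits.BirchSwinnertonDyer.BirchSwinnertonDyer.Theorems.ManinLocalTwoThreeIstarTwoExact
import Summits.BirchSwinnertonDyer.BirchSwinnertonDyer.Theorems.ManinLocalTwoThreePotGoodComponentWindowThree
import HarnessLib

/-!
# Kodaira type `Iₙ*` at `2`, exactly — part 3: `ord₂ j ∈ {4 − n, 8 − n}` over `ℚ`, and S-an-40′ (`pss ⟹ m₂ ≤ 12`)

Summit `BirchSwinnertonDyer`, route `ManinLocalTwoThree` (cell bsd-f2-manin), cruxes C2 `ManinOddAtFour`
(stmt-BirchSwinnertonDyer-22967) and C3 `ManinPrimeToThreeAtNine` (stmt-…-22968).  Parts 1–2 (`…IstarTwoExits`, `…IstarTwoExact`)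
give, for the output `Istar (n + 1)` of Tate's algorithm over a DVR in which `2` is a uniformiser, `(ord c₄, ord Δ) = (4, n + 9)` or
`(6, n + 11)` (`n ≥ 3`; small `n` listed there).  Here (`j · Δ = c₄³` on the local minimal model, as in the tree's
`valuation_j_eq_exp_of_kodairaSymbolAt_eq_Istar_succ` for `v ∤ 2`):

* §4 (local, `O_v` absolutely unramified at `2`): `ordMinimalDiscriminant_valuation_j_of_kodairaSymbolAt_Istar_succ_of_irreducible_two` —
  `v(j) = exp(δ − 12)` with `δ = n + 9` (`n ≥ 1`) / `8` (`n = 0`), or `v(j) = exp(δ − 18)` with `δ = n + 11` (`n ≥ 3`) / `8, 12–13, 12`.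
* §5 over `ℚ` at `2`: `padicValRat_two_j_of_kodairaSymbolAt_Istar_succ` (the same with `ord₂ j = 12 − δ`, resp. `18 − δ`);
  **`kodairaSymbolAt_Istar_two_of_four_le`: type `I_N*` at `2` with `N ≥ 4` has `(δ, f₂, ord₂ j) = (N + 8, 4, 4 − N)` or
  `(N + 10, 6, 8 − N)`**; hence `le_eight_of_kodairaSymbolAt_Istar_two` (potentially good ⟹ `N ≤ 8`),
  `le_seven_of_kodairaSymbolAt_Istar_two` (`ord₂ j > 0` ⟹ `N ≤ 7`), `j_ne_zero_of_kodairaSymbolAt_Istar_succ_two`, and the potentially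
  ORDINARY rows `eq_four_or_eq_eight_of_kodairaSymbolAt_Istar_two_of_padicValRat_j_eq_zero` (`ord₂ j = 0` ⟹ `I₄*` with `δ = 12` or
  `I₈*` with `δ = 18` — an's S-an-47 on the `Iₙ*` stratum).
* §6 **S-an-40′ `PotSupersingularComponentBoundTwo′` BY VALUE** (an g25, MEMO-an §67.11, Sketch-an-g25b :48, `oggComponents` unfolded via the
  prime-uniform dictionary `oggComponents_eq_numComponents_of_sq_dvd` of `…PotGoodComponentWindowThree`):
  `numComponents_le_twelve_of_potSupersingular_two` and `potSupersingularComponentBoundTwo'` — for `W` globally minimal with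
  `4 ∣ N`, `j = 0 ∨ ord₂ j > 0` ⟹ `1 ≤ ord₂Δ_min − ord₂N + 1 ≤ 12`; and the potentially good window `… ≤ 13`
  (`numComponents_le_thirteen_of_potGood_two`).  Census (an g25): 1 018 341 / 1 018 341 pss curves `N < 5·10⁵`, max `m = 12 = I₇*`.

HONEST FRAMING: local structure theorems; E-an-119 (the clock law at `2`) still needs conductor-invariance along the isogeny; C2,
C3, Manin's conjecture and BSD are not proved.  No definitions, no named facts, no sorry.  References: [SilvermanATAEC1994] IV.9.4
Step 7, Table 4.1, IV.11.1; [Papadopoulos1993] Table IV (for comparison only).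
-/

set_option linter.dupNamespace false
set_option autoImplicit false

noncomputable section

open scoped Classical

open WeierstrassCurve IsDedekindDomain IsLocalRing Polynomial
  Literature.NumberTheory.DiophantineGeometry Literature.NumberTheory.DiophantineGeometry.TateAlgorithm
  Literature.NumberTheory.EllipticCurves
open IsDiscreteValuationRing hiding maximalIdeal

namespace Summit.BirchSwinnertonDyer.BirchSwinnertonDyer.Theorems.ManinLocalTwoThree

/-! ### §4 Local: the valuation of `j` at a place where `2` is a uniformiser -/

section Local

variable {A : Type*} [CommRing A] [IsDedekindDomain A] {K : Type*} [Field K]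
  [Algebra A K] [IsFractionRing A K] (v : HeightOneSpectrum A) (W : WeierstrassCurve K)

/-- `v(j) = exp(ord Δ − 3·ord c₄)` on the integral local minimal model (`j · Δ = c₄³` in `K_v`). [cite: SilvermanATAEC1994, IV.9.4 Table 4.1] -/
theorem valuation_j_eq_exp_of_addVal_c₄ [W.IsElliptic] {k : ℕ} (hk : k ≠ 0)
    (hc₄ : (addVal (v.adicCompletionIntegers K) (W.localMinimalIntegralModel v).c₄).toNat = k) :
    v.valuation K W.j = WithZero.exp ((W.ordMinimalDiscriminant v : ℤ) - 3 * k) := by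
  set O := v.adicCompletionIntegers K with hO
  set M := W.localMinimalIntegralModel v with hM
  have hΔ0 : M.Δ ≠ 0 := localMinimalIntegralModel_Δ_ne_zero v W
  have hc₄0 : M.c₄ ≠ 0 := by
    intro h0
    apply hk
    rw [← hc₄, h0]
    simp
  obtain ⟨N, hN, hvΔ⟩ := HeightOneSpectrum.exists_addVal_adicCompletionIntegers_eq K v M.Δ hΔ0
  obtain ⟨N₄, hN₄, hvc₄⟩ := HeightOneSpectrum.exists_addVal_adicCompletionIntegers_eq K v M.c₄ hc₄0
  have hNδ : W.ordMinimalDiscriminant v = N := by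
    unfold ordMinimalDiscriminant
    have := congrArg ENat.toNat hN
    simpa using this
  have hN₄k : N₄ = k := by
    have := congrArg ENat.toNat hN₄
    rw [hc₄] at this
    simpa using this.symm
  rw [hN₄k] at hvc₄
  -- `j · Δ(M) = c₄(M)³` in `K_v`
  have hjΔ : ∀ (E : WeierstrassCurve (v.adicCompletion K)) [E.IsElliptic],
      E.j * E.Δ = E.c₄ ^ 3 := fun E _ ↦ by
    rw [WeierstrassCurve.j, ← coe_Δ', mul_comm, ← mul_assoc, Units.mul_inv, one_mul]
  haveI hXell : (W.baseChange (v.adicCompletion K)).IsElliptic := by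
    unfold baseChange; infer_instance
  obtain ⟨C, hC⟩ : ∃ C : VariableChange (v.adicCompletion K),
      C • W.baseChange (v.adicCompletion K) = W.localMinimalModel v := ⟨_, rfl⟩
  have key : (W.j : v.adicCompletion K) * ((M.Δ : O) : v.adicCompletion K) =
      ((M.c₄ : O) : v.adicCompletion K) ^ 3 := by
    have hj' : (C • W.baseChange (v.adicCompletion K)).j = (W.j : v.adicCompletion K) := by
      rw [variableChange_j]; exact W.map_j _
    have hΔ' : ((M.Δ : O) : v.adicCompletion K) = (C • W.baseChange (v.adicCompletion K)).Δ := by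
      rw [hC, hM, localMinimalIntegralModel]
      exact integralModel_Δ_eq (v.adicCompletionIntegers K) (W.localMinimalModel v)
    have hc₄' : ((M.c₄ : O) : v.adicCompletion K) =
        (C • W.baseChange (v.adicCompletion K)).c₄ := by
      rw [hC, hM, localMinimalIntegralModel]
      exact integralModel_c₄_eq (v.adicCompletionIntegers K) (W.localMinimalModel v)
    rw [hΔ', hc₄', ← hj']
    exact hjΔ _
  have hvj : Valued.v (W.j : v.adicCompletion K) = WithZero.exp ((N : ℤ) - 3 * k) := by
    have h := congrArg Valued.v key
    rw [map_mul, map_pow, hvΔ, hvc₄, ← WithZero.exp_nsmul] at h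
    have hne : WithZero.exp (-(N : ℤ)) ≠ 0 := WithZero.exp_ne_zero
    rw [← eq_div_iff hne] at h
    rw [h, ← WithZero.exp_sub]
    congr 1
    ring
  rw [← HeightOneSpectrum.valuedAdicCompletion_eq_valuation', hvj, hNδ]

/-- **Type `Iₙ*` (`n ≥ 1`) at an absolutely unramified `2`-adic place: `v(j) = exp(δ − 12)` with `δ = ord_v Δ_min ∈ {n + 8}` or
`v(j) = exp(δ − 18)` with `δ = n + 10` (`n ≥ 4`; small `n` as listed)** — stated for `Istar (n + 1)`.
[cite: SilvermanATAEC1994, IV.9.4 Step 7 and Table 4.1] -/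
theorem ordMinimalDiscriminant_valuation_j_of_kodairaSymbolAt_Istar_succ_of_irreducible_two [W.IsElliptic]
    [PerfectField (IsLocalRing.ResidueField (v.adicCompletionIntegers K))]
    (h2 : Irreducible (2 : v.adicCompletionIntegers K)) {n : ℕ} (hT : W.kodairaSymbolAt v = .Istar (n + 1)) :
    (v.valuation K W.j = WithZero.exp ((W.ordMinimalDiscriminant v : ℤ) - 12) ∧
      ((n = 0 ∧ W.ordMinimalDiscriminant v = 8) ∨ (1 ≤ n ∧ W.ordMinimalDiscriminant v = n + 9))) ∨
    (v.valuation K W.j = WithZero.exp ((W.ordMinimalDiscriminant v : ℤ) - 18) ∧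
      ((n = 0 ∧ W.ordMinimalDiscriminant v = 8) ∨
        (n = 1 ∧ 12 ≤ W.ordMinimalDiscriminant v ∧ W.ordMinimalDiscriminant v ≤ 13) ∨
        (n = 2 ∧ W.ordMinimalDiscriminant v = 12) ∨ (3 ≤ n ∧ W.ordMinimalDiscriminant v = n + 11))) := by
  rw [kodairaSymbolAt_def] at hT
  have hΔ0 := localMinimalIntegralModel_Δ_ne_zero v W
  have hδ : W.ordMinimalDiscriminant v =
      (addVal (v.adicCompletionIntegers K) (W.localMinimalIntegralModel v).Δ).toNat := rfl
  rcases IstarCharTwo.addVal_Δ_toNat_of_kodairaSymbolOfMinimal_eq_Istar_succ h2 _ hΔ0 hT with ⟨hc₄, h⟩ | ⟨hc₄, h⟩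
  · left
    refine ⟨by rw [valuation_j_eq_exp_of_addVal_c₄ v W (by norm_num) hc₄]; norm_num, ?_⟩
    rw [hδ]; exact h
  · right
    refine ⟨by rw [valuation_j_eq_exp_of_addVal_c₄ v W (by norm_num) hc₄]; norm_num, ?_⟩
    rw [hδ]; exact h

end Local

/-! ### §5 Over `ℚ` at `2` -/

section Rat

open NumberField Rat.HeightOneSpectrum Summit.BirchSwinnertonDyer.Rank1Residual.Additive

/-- `2` is a uniformiser of `O_v ≃ ℤ₂` at the place `placeOf 2` of `ℤ`. [folklore] -/
theorem irreducible_two_adicCompletionIntegers_placeOf_two :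
    Irreducible (2 : (placeOf 2).adicCompletionIntegers ℚ) := by
  have hgen : natGenerator (placeOf 2) = 2 :=
    congrArg Subtype.val ((primesEquiv (R := ℤ)).apply_symm_apply ⟨2, Nat.prime_two⟩)
  have h := Literature.NumberTheory.DiophantineGeometry.Rat.irreducible_natCast_natGenerator (placeOf 2)
  rw [hgen] at h
  simpa using h

/-- **Over `ℚ`: type `Iₙ*` (`n ≥ 1`) at `2` has `ord₂ j = 12 − δ` with `δ = ord₂ Δ_min = n + 8`, or `ord₂ j = 18 − δ` with `δ = n + 10`
(`n ≥ 4`; for `n = 1, 2, 3`: `δ = 8 | 8`, `10 | 12–13`, `11 | 12`)** — stated for `Istar (n + 1)`.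
[cite: SilvermanATAEC1994, IV.9.4 Step 7 and Table 4.1] -/
theorem padicValRat_two_j_of_kodairaSymbolAt_Istar_succ (W : WeierstrassCurve ℚ) [W.IsElliptic] {n : ℕ}
    (hT : W.kodairaSymbolAt (placeOf 2) = .Istar (n + 1)) :
    (padicValRat 2 W.j = 12 - (W.ordMinimalDiscriminant (placeOf 2) : ℤ) ∧
      ((n = 0 ∧ W.ordMinimalDiscriminant (placeOf 2) = 8) ∨ (1 ≤ n ∧ W.ordMinimalDiscriminant (placeOf 2) = n + 9))) ∨
    (padicValRat 2 W.j = 18 - (W.ordMinimalDiscriminant (placeOf 2) : ℤ) ∧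
      ((n = 0 ∧ W.ordMinimalDiscriminant (placeOf 2) = 8) ∨
        (n = 1 ∧ 12 ≤ W.ordMinimalDiscriminant (placeOf 2) ∧ W.ordMinimalDiscriminant (placeOf 2) ≤ 13) ∨
        (n = 2 ∧ W.ordMinimalDiscriminant (placeOf 2) = 12) ∨
        (3 ≤ n ∧ W.ordMinimalDiscriminant (placeOf 2) = n + 11))) := by
  haveI : PerfectField (IsLocalRing.ResidueField ((placeOf 2).adicCompletionIntegers ℚ)) := PerfectField.ofFinite
  have hgen : natGenerator (placeOf 2) = 2 :=
    congrArg Subtype.val ((primesEquiv (R := ℤ)).apply_symm_apply ⟨2, Nat.prime_two⟩)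
  have hconv : ∀ m : ℤ, (placeOf 2).valuation ℚ W.j = WithZero.exp m → padicValRat 2 W.j = -m := by
    intro m h
    have hj0 : W.j ≠ 0 := by
      intro hj0
      rw [hj0, map_zero] at h
      exact WithZero.exp_ne_zero h.symm
    rw [valuation_eq_exp_neg_padicValRat (placeOf 2) hj0, hgen] at h
    have := WithZero.exp_injective h
    omega
  rcases ordMinimalDiscriminant_valuation_j_of_kodairaSymbolAt_Istar_succ_of_irreducible_two (placeOf 2) W
      irreducible_two_adicCompletionIntegers_placeOf_two hT with ⟨hv, h⟩ | ⟨hv, h⟩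
  · left; exact ⟨by have := hconv _ hv; omega, h⟩
  · right; exact ⟨by have := hconv _ hv; omega, h⟩

/-- **Type `I_N*` at `2` with `N ≥ 4`: `(ord₂ Δ_min, f₂, ord₂ j) = (N + 8, 4, 4 − N)` or `(N + 10, 6, 8 − N)`** (`f₂` by Ogg's formula
`f = δ + 1 − (N + 5)`, the tree's definition of `conductorExponent`). [cite: SilvermanATAEC1994, IV.9.4 Table 4.1 and IV.11.1] -/
theorem kodairaSymbolAt_Istar_two_of_four_le (W : WeierstrassCurve ℚ) [W.IsElliptic] {N : ℕ}
    (hT : W.kodairaSymbolAt (placeOf 2) = .Istar N) (hN : 4 ≤ N) :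
    (W.ordMinimalDiscriminant (placeOf 2) = N + 8 ∧ W.conductorExponent (placeOf 2) = 4 ∧ padicValRat 2 W.j = 4 - (N : ℤ)) ∨
    (W.ordMinimalDiscriminant (placeOf 2) = N + 10 ∧ W.conductorExponent (placeOf 2) = 6 ∧ padicValRat 2 W.j = 8 - (N : ℤ)) := by
  obtain ⟨n, rfl⟩ : ∃ n, N = n + 1 := ⟨N - 1, by omega⟩
  have hf : W.conductorExponent (placeOf 2) = W.ordMinimalDiscriminant (placeOf 2) + 1 - (n + 1 + 5) := by
    unfold conductorExponent numComponentsAt; rw [hT, KodairaSymbol.numComponents_Istar]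
  rcases padicValRat_two_j_of_kodairaSymbolAt_Istar_succ W hT with ⟨hv, h⟩ | ⟨hv, h⟩
  · left
    rcases h with ⟨hn, hd⟩ | ⟨hn, hd⟩
    · omega
    · refine ⟨by omega, by omega, by rw [hv, hd]; omega⟩
  · right
    rcases h with ⟨hn, hd⟩ | ⟨hn, hlo, hhi⟩ | ⟨hn, hd⟩ | ⟨hn, hd⟩
    · omega
    · omega
    · omega
    · refine ⟨by omega, by omega, by rw [hv, hd]; omega⟩

/-- `Iₙ*` (`n ≥ 1`) at `2` has `j ≠ 0` (`ord₂ c₄ ∈ {4, 6}` is finite). [cite: SilvermanATAEC1994, IV.9.4 Table 4.1] -/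
theorem j_ne_zero_of_kodairaSymbolAt_Istar_succ_two (W : WeierstrassCurve ℚ) [W.IsElliptic] {n : ℕ}
    (hT : W.kodairaSymbolAt (placeOf 2) = .Istar (n + 1)) : W.j ≠ 0 := by
  haveI : PerfectField (IsLocalRing.ResidueField ((placeOf 2).adicCompletionIntegers ℚ)) := PerfectField.ofFinite
  intro hj0
  rcases ordMinimalDiscriminant_valuation_j_of_kodairaSymbolAt_Istar_succ_of_irreducible_two (placeOf 2) W
      irreducible_two_adicCompletionIntegers_placeOf_two hT with ⟨hv, -⟩ | ⟨hv, -⟩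
  · rw [hj0, map_zero] at hv; exact WithZero.exp_ne_zero hv.symm
  · rw [hj0, map_zero] at hv; exact WithZero.exp_ne_zero hv.symm

/-- **Potentially good `Iₙ*` at `2` has `n ≤ 8`** (`ord₂ j ≥ 0`). [cite: SilvermanATAEC1994, IV.9.4 Table 4.1] -/
theorem le_eight_of_kodairaSymbolAt_Istar_two (W : WeierstrassCurve ℚ) [W.IsElliptic] {N : ℕ}
    (hT : W.kodairaSymbolAt (placeOf 2) = .Istar N) (hj : 0 ≤ padicValRat 2 W.j) : N ≤ 8 := by
  by_cases hN : 4 ≤ N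
  · rcases kodairaSymbolAt_Istar_two_of_four_le W hT hN with ⟨-, -, hv⟩ | ⟨-, -, hv⟩ <;> omega
  · omega

/-- **Potentially supersingular `Iₙ*` at `2` has `n ≤ 7`** (`ord₂ j > 0`; census an g25: the maximum `m = 12` is `I₇*`).
[cite: SilvermanATAEC1994, IV.9.4 Table 4.1] -/
theorem le_seven_of_kodairaSymbolAt_Istar_two (W : WeierstrassCurve ℚ) [W.IsElliptic] {N : ℕ}
    (hT : W.kodairaSymbolAt (placeOf 2) = .Istar N) (hj : 0 < padicValRat 2 W.j) : N ≤ 7 := by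
  by_cases hN : 4 ≤ N
  · rcases kodairaSymbolAt_Istar_two_of_four_le W hT hN with ⟨-, -, hv⟩ | ⟨-, -, hv⟩ <;> omega
  · omega

/-- **The potentially ORDINARY `Iₙ*` at `2` (`ord₂ j = 0`, `n ≥ 1`) are `I₄*` with `(δ, f₂) = (12, 4)` and `I₈*` with `(18, 6)`**
(an's S-an-47 `PotOrdinaryAdditiveShapeTwo` on the `Iₙ*` stratum; census 26 573 + 13 720). [cite: SilvermanATAEC1994, IV.9.4 Table 4.1] -/
theorem eq_four_or_eq_eight_of_kodairaSymbolAt_Istar_two_of_padicValRat_j_eq_zero (W : WeierstrassCurve ℚ) [W.IsElliptic]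
    {N : ℕ} (hT : W.kodairaSymbolAt (placeOf 2) = .Istar N) (hN : 1 ≤ N) (hj : padicValRat 2 W.j = 0) :
    (N = 4 ∧ W.ordMinimalDiscriminant (placeOf 2) = 12 ∧ W.conductorExponent (placeOf 2) = 4) ∨
    (N = 8 ∧ W.ordMinimalDiscriminant (placeOf 2) = 18 ∧ W.conductorExponent (placeOf 2) = 6) := by
  by_cases h4 : 4 ≤ N
  · rcases kodairaSymbolAt_Istar_two_of_four_le W hT h4 with ⟨hd, hf, hv⟩ | ⟨hd, hf, hv⟩
    · left; exact ⟨by omega, by rw [hd]; omega, hf⟩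
    · right; exact ⟨by omega, by rw [hd]; omega, hf⟩
  · exfalso
    obtain ⟨n, rfl⟩ : ∃ n, N = n + 1 := ⟨N - 1, by omega⟩
    rcases padicValRat_two_j_of_kodairaSymbolAt_Istar_succ W hT with ⟨hv, h⟩ | ⟨hv, h⟩
    · rcases h with ⟨-, hd⟩ | ⟨-, hd⟩ <;> omega
    · rcases h with ⟨-, hd⟩ | ⟨-, hlo, hhi⟩ | ⟨-, hd⟩ | ⟨-, hd⟩ <;> omega


/-! ### §6 S-an-40′: the component window at `2` (`pss ⟹ 1 ≤ m₂ ≤ 12`, potentially good ⟹ `m₂ ≤ 13`) -/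

/-- **Potentially good at `2` ⟹ `m₂ ≤ 13`** (additive `W` at `2` with `ord₂ j ≥ 0`: on `Iₙ*` one has `n ≤ 8`, elsewhere `m ≤ 9`).
[cite: SilvermanATAEC1994, IV.9.4 Table 4.1] -/
theorem numComponents_le_thirteen_of_potGood_two (W : WeierstrassCurve ℚ) [W.IsElliptic]
    (hadd : (W.kodairaSymbolAt (placeOf 2)).IsAdditive) (hj : 0 ≤ padicValRat 2 W.j) :
    (W.kodairaSymbolAt (placeOf 2)).numComponents ≤ 13 := by
  rcases eq_of_isAdditive hadd with h | h | h | ⟨N, hN⟩ | h | h | h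
  all_goals try (rw [h]; simp [KodairaSymbol.numComponents])
  have := le_eight_of_kodairaSymbolAt_Istar_two W hN hj
  rw [hN, KodairaSymbol.numComponents_Istar]; omega

/-- **Potentially supersingular at `2` ⟹ `m₂ ≤ 12`** (additive `W` at `2` with `j = 0` or `ord₂ j > 0`: on `Iₙ*` one has `n ≤ 7`
— `j = 0` is impossible there for `n ≥ 1` —, elsewhere `m ≤ 9`). [cite: SilvermanATAEC1994, IV.9.4 Table 4.1] -/
theorem numComponents_le_twelve_of_potSupersingular_two (W : WeierstrassCurve ℚ) [W.IsElliptic]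
    (hadd : (W.kodairaSymbolAt (placeOf 2)).IsAdditive) (hss : W.j = 0 ∨ 0 < padicValRat 2 W.j) :
    (W.kodairaSymbolAt (placeOf 2)).numComponents ≤ 12 := by
  rcases eq_of_isAdditive hadd with h | h | h | ⟨N, hN⟩ | h | h | h
  all_goals try (rw [h]; simp [KodairaSymbol.numComponents])
  rw [hN, KodairaSymbol.numComponents_Istar]
  rcases hss with hj0 | hj
  · rcases N with _ | n
    · omega
    · exact absurd hj0 (j_ne_zero_of_kodairaSymbolAt_Istar_succ_two W hN)
  · have := le_seven_of_kodairaSymbolAt_Istar_two W hN hj; omega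

/-- **S-an-40′ `PotSupersingularComponentBoundTwo′` BY VALUE** (an g25, Sketch-an-g25b :48, `oggComponents 2 W` unfolded): a globally
minimal `W` with `4 ∣ N` which is potentially supersingular at `2` (`j = 0` or `ord₂ j > 0`) has `1 ≤ ord₂ Δ_min − ord₂ N + 1 ≤ 12`.
The ONE census-only input of the clock law E-an-119 at `2` (MEMO-an §67.11; census 1 018 341 / 1 018 341, max `m = 12 = I₇*`), now a
theorem of Tate's algorithm. [cite: SilvermanATAEC1994, IV.9.4 Step 7, Table 4.1 and IV.11.1] -/
theorem potSupersingularComponentBoundTwo' (W : WeierstrassCurve ℚ) [W.IsElliptic] [W.IsGloballyMinimal]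
    (h4 : 2 ^ 2 ∣ W.conductorNorm ℤ) (hss : W.j = 0 ∨ 0 < padicValRat 2 W.j) :
    1 ≤ ((padicValInt 2 W.minimalDiscriminantInt : ℕ) : ℤ) - (padicValNat 2 (W.conductorNorm ℤ) : ℤ) + 1 ∧
      ((padicValInt 2 W.minimalDiscriminantInt : ℕ) : ℤ) - (padicValNat 2 (W.conductorNorm ℤ) : ℤ) + 1 ≤ 12 := by
  obtain ⟨heq, hadd⟩ := oggComponents_eq_numComponents_of_sq_dvd W 2 h4
  rw [heq]
  have h1 := (W.kodairaSymbolAt (placeOf 2)).numComponents_pos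
  have h12 := numComponents_le_twelve_of_potSupersingular_two W hadd hss
  exact ⟨by exact_mod_cast h1, by exact_mod_cast h12⟩

/-- **The potentially good window at `2`:** a globally minimal `W` with `4 ∣ N` and `ord₂ j ≥ 0` has `1 ≤ ord₂ Δ_min − ord₂ N + 1 ≤ 13`,
and `= 13` only on `I₈*` (potentially ordinary, `(δ, f) = (18, 6)`). [cite: SilvermanATAEC1994, IV.9.4 Table 4.1 and IV.11.1] -/
theorem potGoodComponentWindowTwo (W : WeierstrassCurve ℚ) [W.IsElliptic] [W.IsGloballyMinimal]
    (h4 : 2 ^ 2 ∣ W.conductorNorm ℤ) (hj : 0 ≤ padicValRat 2 W.j) :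
    1 ≤ ((padicValInt 2 W.minimalDiscriminantInt : ℕ) : ℤ) - (padicValNat 2 (W.conductorNorm ℤ) : ℤ) + 1 ∧
      ((padicValInt 2 W.minimalDiscriminantInt : ℕ) : ℤ) - (padicValNat 2 (W.conductorNorm ℤ) : ℤ) + 1 ≤ 13 ∧
      (((padicValInt 2 W.minimalDiscriminantInt : ℕ) : ℤ) - (padicValNat 2 (W.conductorNorm ℤ) : ℤ) + 1 = 13 →
        W.kodairaSymbolAt (placeOf 2) = .Istar 8 ∧ padicValRat 2 W.j = 0 ∧ padicValInt 2 W.minimalDiscriminantInt = 18 ∧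
          padicValNat 2 (W.conductorNorm ℤ) = 6) := by
  obtain ⟨heq, hadd⟩ := oggComponents_eq_numComponents_of_sq_dvd W 2 h4
  rw [heq]
  have h1 := (W.kodairaSymbolAt (placeOf 2)).numComponents_pos
  have h13 := numComponents_le_thirteen_of_potGood_two W hadd hj
  refine ⟨by exact_mod_cast h1, by exact_mod_cast h13, fun h ↦ ?_⟩
  have hm : (W.kodairaSymbolAt (placeOf 2)).numComponents = 13 := by exact_mod_cast h
  rcases eq_of_isAdditive hadd with h | h | h | ⟨N, hN⟩ | h | h | h
  all_goals try (rw [h] at hm; simp [KodairaSymbol.numComponents] at hm)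
  rw [hN, KodairaSymbol.numComponents_Istar] at hm
  have hN8 : N = 8 := by omega
  subst hN8
  rcases kodairaSymbolAt_Istar_two_of_four_le W hN (by norm_num) with ⟨hd, hf, hv⟩ | ⟨hd, hf, hv⟩
  · omega
  · have hδ : W.ordMinimalDiscriminant (placeOf 2) = padicValInt 2 W.minimalDiscriminantInt := ordMinimalDiscriminant_placeOf_eq W 2
    have hfac : (W.conductorNorm ℤ).factorization 2 = W.conductorExponent (placeOf 2) :=
      factorization_conductorNorm_primesEquiv_symm W ⟨2, Nat.prime_two⟩
    refine ⟨hN, by omega, by rw [← hδ, hd], ?_⟩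
    rw [← Nat.factorization_def _ Nat.prime_two, hfac, hf]

end Rat

end Summit.BirchSwinnertonDyer.BirchSwinnertonDyer.Theorems.ManinLocalTwoThree

end
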